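import Summits.HubbardSuperconductivity.HubbardSuperconductivity.Theorems.BcsKacWindowInfraredCompletionSqrtShape
import Summits.HubbardSuperconductivity.HubbardSuperconductivity.Theorems.FunctionFieldCertificateWindowInfraredBoundReductions

/-!
# Crux `InfraredCompletion` (stmt-HubbardSuperconductivity-1321, route BcsKacWindow), line `birth`:
# the sqrt-shape (stub B3 of skeleton v5) is WEAKER than the relative Goldstone shape (stub B2' of v4)

Companion of `BcsKacWindowInfraredCompletionSqrtShape.lean` (the window bootstrap: floor + sqrt-shape
⇒ bulk order). Here: the Parseval ceiling `S_ψ(m) ≤ Σ_{m'} S_ψ(m') = Σ_x ‖P_x ψ‖² ≤ 32 L²` for a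
normalised Fock vector (reusing the landed `wib_sum_pairStructureFactor_le` of the sibling crux
`WindowInfraredBound`, routes FunctionFieldCertificate / KacWindowPenalty), and consequently B2' ⇒ B3: the pointwise relative Goldstone shape with
background `S_ψ(m)|q_m|L² ≤ A S_ψ(0) + B|q_m|L²` implies the sqrt-shape
`S_ψ(m)|q_m|L² ≤ A' L √S_ψ(0) + D Δ(U) L² + B|q_m|L²` with `(A', D) = (A√32, 0)`
(`sqrtShape_of_shapeBg`), since `A S(0) = A √S(0) √S(0) ≤ A √32 L √S(0)`. So skeleton v5 of line
`birth` (stubs A + B3) asks for no more than v4 (stubs A + B2') did, and the landed v4 reduction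
factors through the v5 one. No definitions, no named facts, `sorry`-free.

Sources: T. Kennedy, E. H. Lieb, B. S. Shastry, PRL **61** (1988) 2582 (Parseval sum rule for the
Fourier modes of an order operator); D. J. Scalapino, Phys. Rep. **250** (1995) 329, §2 (the
`d`-wave pair field); C. N. Yang, Rev. Mod. Phys. **34** (1962) 694 (a-priori bounds on pair
correlations). Lead c15, 2026-08-17. [folklore]
-/

noncomputable section

-- the mandated namespace `Summit.<Summit>.<Problem>.Theorems…` repeats `HubbardSuperconductivity`
-- (single-problem summit, D-0017), which the `dupNamespace` linter flags on every declaration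
set_option linter.dupNamespace false

namespace Summit.HubbardSuperconductivity.HubbardSuperconductivity.Theorems.InfraredCompletion

open Literature.MathematicalPhysics.QuantumLattice Literature.Probability.LatticeModels
open scoped Matrix

/-! ### B2' ⇒ B3: the sqrt-shape is weaker than the relative Goldstone shape -/

/-- **Parseval ceiling for one mode**: for a normalised Fock vector and every label `m`,
`S_ψ(m) ≤ Σ_{m'} S_ψ(m') = Σ_x ‖P_x ψ‖² ≤ 32 L²` (the landed Parseval ceiling
`wib_sum_pairStructureFactor_le` of the sibling crux `WindowInfraredBound`).
Kennedy–Lieb–Shastry, PRL 61 (1988) 2582 (Parseval sum rule). [folklore] -/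
theorem pairStructureFactor_le_sumRule (L : ℕ) [NeZero L] (ψ : Fock (Orb (FermionTorus 2 L)))
    (hψ : star ψ ⬝ᵥ ψ = 1) (m : TorusSite 2 L) :
    pairStructureFactor dWaveFormFactor L ψ m ≤ 32 * (L : ℝ) ^ 2 := by
  have hsingle : pairStructureFactor dWaveFormFactor L ψ m ≤
      ∑ m', pairStructureFactor dWaveFormFactor L ψ m' :=
    Finset.single_le_sum (f := fun m' => pairStructureFactor dWaveFormFactor L ψ m')
      (fun m' _ => pairStructureFactor_nonneg _ _ _ _) (Finset.mem_univ m)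
  exact le_trans hsingle (wib_sum_pairStructureFactor_le L ψ hψ)

/-- **B2' ⇒ B3.** The relative Goldstone shape with background (stub `stub_goldstoneShapeBg` of
skeleton v4) implies the sqrt-shape (stub `stub_sqrtGoldstoneShape` of skeleton v5) with
`(A, D, B, t₀, U_R) ↦ (A√32, 0, B, t₀, U_R)`: for a normalised vector `S_ψ(0) ≤ 32 L²`
(`pairStructureFactor_le_sumRule`), so `A · S_ψ(0) = A √S(0) · √S(0) ≤ A √32 · L · √S(0)`.
So skeleton v5 asks for no more than v4 did. [folklore] -/
theorem sqrtShape_of_shapeBg :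
    (∀ (a b κ₁ κ₂ c₀ s₀ : ℝ) (Δ : ℝ → ℝ), 0 < a → a < b → b < 1 / 2 → 0 < κ₁ → κ₁ ≤ κ₂ →
      0 < c₀ → 0 < s₀ →
      (∀ U : ℝ, 0 < U → Real.exp (-(κ₂ / U ^ 2)) ≤ Δ U ∧ Δ U ≤ Real.exp (-(κ₁ / U ^ 2))) →
      (∀ s : ℝ, s₀ ≤ s → ∃ U₁ : ℝ, 0 < U₁ ∧ ∀ δ ∈ Set.Icc a b, ∀ U ∈ Set.Ioo (0:ℝ) U₁,
        ∀ (L : ℕ) [NeZero L], Even L → s₀ ≤ Δ U * L → Δ U * L ≤ s →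
          ∀ ψ : Fock (Orb (FermionTorus 2 L)), star ψ ⬝ᵥ ψ = 1 →
            IsGroundStateInSector (hubbardTorus 2 L 1 U) (2 * ⌊(1 - δ) * (L : ℝ) ^ 2 / 2⌋₊) 0 ψ →
              c₀ * Δ U ^ 2 ≤ (expect ((pairField dWaveFormFactor L)ᴴ * pairField dWaveFormFactor L)
                ψ).re / (L : ℝ) ^ 4) →
      ∃ A B t₀ UR : ℝ, 0 ≤ A ∧ 0 ≤ B ∧ 0 < t₀ ∧ 0 < UR ∧
        ∀ δ ∈ Set.Icc a b, ∀ U ∈ Set.Ioo (0:ℝ) UR, ∀ (L : ℕ) [NeZero L], Even L → t₀ ≤ Δ U * L →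
          ∀ ψ : Fock (Orb (FermionTorus 2 L)), star ψ ⬝ᵥ ψ = 1 →
            IsGroundStateInSector (hubbardTorus 2 L 1 U) (2 * ⌊(1 - δ) * (L : ℝ) ^ 2 / 2⌋₊) 0 ψ →
              ∀ m : Fin 2 → ZMod L, m ≠ 0 → momentumNormSq L m ≤ (Δ U / t₀) ^ 2 →
                pairStructureFactor dWaveFormFactor L ψ m * Real.sqrt (momentumNormSq L m) *
                    (L : ℝ) ^ 2 ≤
                  A * pairStructureFactor dWaveFormFactor L ψ 0 +
                    B * Real.sqrt (momentumNormSq L m) * (L : ℝ) ^ 2) →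
    ∀ (a b κ₁ κ₂ c₀ s₀ : ℝ) (Δ : ℝ → ℝ), 0 < a → a < b → b < 1 / 2 → 0 < κ₁ → κ₁ ≤ κ₂ →
      0 < c₀ → 0 < s₀ →
      (∀ U : ℝ, 0 < U → Real.exp (-(κ₂ / U ^ 2)) ≤ Δ U ∧ Δ U ≤ Real.exp (-(κ₁ / U ^ 2))) →
      (∀ s : ℝ, s₀ ≤ s → ∃ U₁ : ℝ, 0 < U₁ ∧ ∀ δ ∈ Set.Icc a b, ∀ U ∈ Set.Ioo (0:ℝ) U₁,
        ∀ (L : ℕ) [NeZero L], Even L → s₀ ≤ Δ U * L → Δ U * L ≤ s →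
          ∀ ψ : Fock (Orb (FermionTorus 2 L)), star ψ ⬝ᵥ ψ = 1 →
            IsGroundStateInSector (hubbardTorus 2 L 1 U) (2 * ⌊(1 - δ) * (L : ℝ) ^ 2 / 2⌋₊) 0 ψ →
              c₀ * Δ U ^ 2 ≤ (expect ((pairField dWaveFormFactor L)ᴴ * pairField dWaveFormFactor L)
                ψ).re / (L : ℝ) ^ 4) →
      ∃ A D B t₀ UR : ℝ, 0 ≤ A ∧ 0 ≤ D ∧ 0 ≤ B ∧ 0 < t₀ ∧ 0 < UR ∧
        ∀ δ ∈ Set.Icc a b, ∀ U ∈ Set.Ioo (0:ℝ) UR, ∀ (L : ℕ) [NeZero L], Even L → t₀ ≤ Δ U * L →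
          ∀ ψ : Fock (Orb (FermionTorus 2 L)), star ψ ⬝ᵥ ψ = 1 →
            IsGroundStateInSector (hubbardTorus 2 L 1 U) (2 * ⌊(1 - δ) * (L : ℝ) ^ 2 / 2⌋₊) 0 ψ →
              ∀ m : Fin 2 → ZMod L, m ≠ 0 → momentumNormSq L m ≤ (Δ U / t₀) ^ 2 →
                pairStructureFactor dWaveFormFactor L ψ m * Real.sqrt (momentumNormSq L m) *
                    (L : ℝ) ^ 2 ≤
                  A * (L : ℝ) * Real.sqrt (pairStructureFactor dWaveFormFactor L ψ 0) +
                    D * Δ U * (L : ℝ) ^ 2 +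
                      B * Real.sqrt (momentumNormSq L m) * (L : ℝ) ^ 2 := by
  intro hB a b κ₁ κ₂ c₀ s₀ Δ ha hab hb hκ₁ hκ₁₂ hc₀ hs₀ hpin hW
  obtain ⟨A, B, t₀, UR, hA, hB0, ht₀, hUR, hsh⟩ :=
    hB a b κ₁ κ₂ c₀ s₀ Δ ha hab hb hκ₁ hκ₁₂ hc₀ hs₀ hpin hW
  refine ⟨A * Real.sqrt 32, 0, B, t₀, UR, by positivity, le_rfl, hB0, ht₀, hUR, ?_⟩
  intro δ hδ U hU L _ hL htL ψ hψ hGS m hm0 hm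
  have h := hsh δ hδ U hU L hL htL ψ hψ hGS m hm0 hm
  have hL0 : (0 : ℝ) ≤ (L : ℝ) := Nat.cast_nonneg L
  set x : ℝ := pairStructureFactor dWaveFormFactor L ψ 0 with hxdef
  have hx : 0 ≤ x := pairStructureFactor_nonneg _ _ _ _
  have hx32 : x ≤ 32 * (L : ℝ) ^ 2 := pairStructureFactor_le_sumRule L ψ hψ 0
  have hsqx : Real.sqrt x ≤ Real.sqrt 32 * (L : ℝ) := by
    calc Real.sqrt x ≤ Real.sqrt (32 * (L : ℝ) ^ 2) := Real.sqrt_le_sqrt hx32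
      _ = Real.sqrt 32 * (L : ℝ) := by
          rw [Real.sqrt_mul (by norm_num : (0:ℝ) ≤ 32), Real.sqrt_sq hL0]
  have hAx : A * x ≤ A * Real.sqrt 32 * (L : ℝ) * Real.sqrt x := by
    have hxx : x = Real.sqrt x * Real.sqrt x := (Real.mul_self_sqrt hx).symm
    calc A * x = A * (Real.sqrt x * Real.sqrt x) := by rw [← hxx]
      _ ≤ A * (Real.sqrt 32 * (L : ℝ) * Real.sqrt x) := by
          refine mul_le_mul_of_nonneg_left ?_ hA
          exact mul_le_mul_of_nonneg_right hsqx (Real.sqrt_nonneg x)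
      _ = A * Real.sqrt 32 * (L : ℝ) * Real.sqrt x := by ring
  calc pairStructureFactor dWaveFormFactor L ψ m * Real.sqrt (momentumNormSq L m) * (L : ℝ) ^ 2
      ≤ A * x + B * Real.sqrt (momentumNormSq L m) * (L : ℝ) ^ 2 := h
    _ ≤ A * Real.sqrt 32 * (L : ℝ) * Real.sqrt x + 0 * Δ U * (L : ℝ) ^ 2 +
          B * Real.sqrt (momentumNormSq L m) * (L : ℝ) ^ 2 := by linarith only [hAx]

end Summit.HubbardSuperconductivity.HubbardSuperconductivity.Theorems.InfraredCompletion

end
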